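import Literature.Probability.RandomPlanarGeometry.RadialBesselContinuity
import HarnessLib

/-!
# Regularity of the exit functionals of the radial Bessel process: LSW's Lemma 2.2 made honest

Topic `Probability/RandomPlanarGeometry`; theorems and auxiliary definitions (the explicit solution
of the inhomogeneous equation), sequel of `RadialBesselContinuity`. For the SLE_κ radial Bessel
process (LSW (2002), (2.9)–(2.11)), `κ > 4`, and `ψ ∈ C¹(ℝ)` with `ψ, ψ'` bounded (`ψ'` continuous),
the exit functionals `a_ψ(y) = E^y[ψ(T); Y_T = 2π]` (`topExpect`) and `b_ψ` (`botExpect`) are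
**twice continuously differentiable on `(0, 2π)` and satisfy**

  `(κ/2) a_ψ'' + cot(y/2) a_ψ' + a_{ψ'} = 0`

(`contDiffAt_topExpect`, `expGenerator_topExpect_eq`; and `…botExpect…`). With `ψ = u(t - ·)` this
is the space part of LSW's PDE (2.4) for `h(θ, t) = E^θ[u(t - T); ·]`, i.e. the statement "the
theory of diffusion processes and (2.10), (2.11) imply that `h(θ, t)` is smooth" of the proof of
Lemma 2.2 (p. 6), here PROVED without any parabolic theory:

* the inhomogeneous equation `(κ/2) w'' + cot(y/2) w' = -f` (`f` continuous on `(0, 2π)`) has the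
  explicit `C²` solution `w = harmSol κ f`, `w' = -(2/κ) (∫_π^y sin(u/2)^{4/κ} f(u) du)/sin(y/2)^{4/κ}`
  (integrating factor `sin(y/2)^{4/κ}`);
* by Dynkin's formula at the exit time `τ` of a short interval `(θ₁, θ₂)` for a global `C²`
  extension of `w` (`RadialBesselContinuity`, `RadialBesselODE`), `E[w(Y_τ)] = w(θ) - E[∫₀^τ a_{ψ'}(Y_s) ds]`,
  while `E[a_ψ(Y_τ)] = a_ψ(θ) - E[∫₀^τ a_{ψ'}(Y_s) ds]` is the Dynkin identity of
  `RadialBesselDynkin` (strong Markov property, no regularity); hence `a_ψ - w` has the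
  mean-value property for the two-point exit and equals an affine function of the scale function
  on `(θ₁, θ₂)` (`topExpect_eq_harmSol_add`) — which is `C²` with `Λ₀ = 0`.

## References

* G. F. Lawler, O. Schramm, W. Werner, *One-arm exponent for critical 2D percolation*, Electron.
  J. Probab. 7 (2002), no. 2, §2, Lemma 2.2 and its proof (p. 6). [LawlerSchrammWernerEJP2002]
* G. F. Lawler, *Conformally Invariant Processes in the Plane*, AMS (2005), §1.11.
  [Lawler2005]
-/

noncomputable section

open MeasureTheory ProbabilityTheory Filter Topology Set
open scoped NNReal ENNReal

namespace Literature.Probability.RandomPlanarGeometry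

namespace RadialLoewner

open Literature.Probability.Process Literature.Analysis.FunctionSpaces

variable {κ : ℝ≥0} {n : ℕ} {θ : ℝ}

/-! ### A `C²` criterion -/

/-- A function with a derivative `g` which has a continuous derivative `h` on an open set is `C²`
there. [folklore] -/
theorem contDiffOn_two_of_hasDerivAt {f g h : ℝ → ℝ} {s : Set ℝ} (hs : IsOpen s)
    (hf : ∀ x ∈ s, HasDerivAt f (g x) x) (hg : ∀ x ∈ s, HasDerivAt g (h x) x) (hh : ContinuousOn h s) :
    ContDiffOn ℝ 2 f s := by
  have hdf : DifferentiableOn ℝ f s := fun x hx ↦ (hf x hx).differentiableAt.differentiableWithinAt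
  have hdg : DifferentiableOn ℝ g s := fun x hx ↦ (hg x hx).differentiableAt.differentiableWithinAt
  have hderf : ∀ x ∈ s, deriv f x = g x := fun x hx ↦ (hf x hx).deriv
  have hderg : ∀ x ∈ s, deriv g x = h x := fun x hx ↦ (hg x hx).deriv
  have h1 : ContDiffOn ℝ 1 g s := by
    rw [show (1 : WithTop ℕ∞) = 0 + 1 from rfl, contDiffOn_succ_iff_deriv_of_isOpen hs]
    refine ⟨hdg, fun h ↦ absurd h (by simp), ?_⟩
    rw [contDiffOn_zero]
    exact hh.congr hderg
  rw [show (2 : WithTop ℕ∞) = 1 + 1 from rfl, contDiffOn_succ_iff_deriv_of_isOpen hs]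
  refine ⟨hdf, fun h ↦ absurd h (by simp), ?_⟩
  exact h1.congr hderf

/-! ### Linearity of the generator -/

/-- `iteratedDeriv 2 f = deriv (deriv f)`. [folklore] -/
theorem iteratedDeriv_two_eq (f : ℝ → ℝ) : iteratedDeriv 2 f = deriv (deriv f) := by
  rw [iteratedDeriv_succ, iteratedDeriv_one]

/-- `Λ_μ (f + g) = Λ_μ f + Λ_μ g` at a point of an open set where both are `C²`. [folklore] -/
theorem expGenerator_add_of_contDiffOn {f g : ℝ → ℝ} {s : Set ℝ} (hs : IsOpen s)
    (hf : ContDiffOn ℝ 2 f s) (hg : ContDiffOn ℝ 2 g s) {y : ℝ} (hy : y ∈ s) (μ : ℝ) :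
    expGenerator κ μ (fun z ↦ f z + g z) y = expGenerator κ μ f y + expGenerator κ μ g y := by
  have hf1 : DifferentiableOn ℝ f s := hf.differentiableOn (by norm_num)
  have hg1 : DifferentiableOn ℝ g s := hg.differentiableOn (by norm_num)
  have hdf : DifferentiableOn ℝ (deriv f) s :=
    (hf.deriv_of_isOpen hs (m := 1) (by norm_num)).differentiableOn (by norm_num)
  have hdg : DifferentiableOn ℝ (deriv g) s :=
    (hg.deriv_of_isOpen hs (m := 1) (by norm_num)).differentiableOn (by norm_num)
  have hsum : deriv (fun z ↦ f z + g z) =ᶠ[𝓝 y] fun z ↦ deriv f z + deriv g z := by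
    filter_upwards [hs.mem_nhds hy] with z hz
    exact deriv_add (hf1.differentiableAt (hs.mem_nhds hz)) (hg1.differentiableAt (hs.mem_nhds hz))
  have hsum2 : deriv (fun z ↦ deriv f z + deriv g z) y = deriv (deriv f) y + deriv (deriv g) y :=
    deriv_add (hdf.differentiableAt (hs.mem_nhds hy)) (hdg.differentiableAt (hs.mem_nhds hy))
  rw [expGenerator_apply, expGenerator_apply, expGenerator_apply, iteratedDeriv_two_eq, iteratedDeriv_two_eq,
    iteratedDeriv_two_eq, hsum.deriv_eq, hsum.eq_of_nhds, hsum2]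
  ring

/-- `Λ_μ (c + f) = μ c + Λ_μ f`. [folklore] -/
theorem expGenerator_const_add (c : ℝ) (f : ℝ → ℝ) (y μ : ℝ) :
    expGenerator κ μ (fun z ↦ c + f z) y = μ * c + expGenerator κ μ f y := by
  have h1 : deriv (fun z ↦ c + f z) = deriv f := by funext z; exact deriv_const_add c
  rw [expGenerator_apply, expGenerator_apply, iteratedDeriv_two_eq, iteratedDeriv_two_eq, h1]
  ring

/-- `Λ_μ (c f) = c Λ_μ f`. [folklore] -/
theorem expGenerator_const_mul (c : ℝ) (f : ℝ → ℝ) (y μ : ℝ) :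
    expGenerator κ μ (fun z ↦ c * f z) y = c * expGenerator κ μ f y := by
  have h1 : deriv (fun z ↦ c * f z) = fun z ↦ c * deriv f z := by funext z; exact deriv_const_mul_field c
  have h2 : deriv (fun z ↦ c * deriv f z) = fun z ↦ c * deriv (deriv f) z := by
    funext z; exact deriv_const_mul_field c
  rw [expGenerator_apply, expGenerator_apply, iteratedDeriv_two_eq, iteratedDeriv_two_eq, h1, h2]
  ring

/-! ### The explicit solution of `(κ/2) w'' + cot(y/2) w' = -f` -/

/-- The **integrating factor** `m(y) = sin(y/2)^{4/κ}` of `(κ/2) ∂² + cot(y/2) ∂`: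
`(m w')' = (2/κ) m ((κ/2) w'' + cot(y/2) w')`. (The reciprocal of the scale density
`sleScaleDensity`.) [folklore] -/
def harmWeight (κ : ℝ≥0) (y : ℝ) : ℝ := Real.sin (y / 2) ^ ((4 : ℝ) / κ)

/-- The **flux** `∫_π^y m(u) f(u) du`. [folklore] -/
def harmFlux (κ : ℝ≥0) (f : ℝ → ℝ) (y : ℝ) : ℝ := ∫ u in Real.pi..y, harmWeight κ u * f u

/-- The derivative `w' = -(2/κ) (flux)/m` of the particular solution. [folklore] -/
def harmDeriv (κ : ℝ≥0) (f : ℝ → ℝ) (y : ℝ) : ℝ := -(2 / κ) * harmFlux κ f y / harmWeight κ y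

/-- **The particular solution `w(y) = ∫_π^y w'` of `(κ/2) w'' + cot(y/2) w' = -f` on `(0, 2π)`**
(normalised by `w(π) = w'(π) = 0`). [folklore] -/
def harmSol (κ : ℝ≥0) (f : ℝ → ℝ) (y : ℝ) : ℝ := ∫ u in Real.pi..y, harmDeriv κ f u

section Calculus

variable (hκ : 4 < κ) {f : ℝ → ℝ} (hf : ContinuousOn f (Ioo 0 (2 * Real.pi)))

/-- `m > 0` on `(0, 2π)`. [folklore] -/
theorem harmWeight_pos (κ : ℝ≥0) {y : ℝ} (hy : y ∈ Ioo 0 (2 * Real.pi)) : 0 < harmWeight κ y :=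
  Real.rpow_pos_of_pos (sin_half_pos hy) _

/-- `m' = (2/κ) m cot(y/2)` on `(0, 2π)`. [folklore] -/
theorem hasDerivAt_harmWeight (κ : ℝ≥0) {y : ℝ} (hy : y ∈ Ioo 0 (2 * Real.pi)) :
    HasDerivAt (harmWeight κ) (2 / κ * harmWeight κ y * Real.cot (y / 2)) y := by
  have hs := sin_half_pos hy
  have h := hasDerivAt_sinPow (m := 2) (q := (4 : ℝ) / κ) (y := y) hs
  have heq : (4 : ℝ) / κ * Real.sin (y / 2) ^ ((4 : ℝ) / κ) * Real.cos (y / 2) / (2 * Real.sin (y / 2)) =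
      2 / κ * harmWeight κ y * Real.cot (y / 2) := by
    rw [harmWeight, Real.cot_eq_cos_div_sin]
    field_simp
    ring
  rw [← heq]
  exact h

/-- `m` is continuous on `(0, 2π)`. [folklore] -/
theorem continuousOn_harmWeight (κ : ℝ≥0) : ContinuousOn (harmWeight κ) (Ioo 0 (2 * Real.pi)) :=
  fun _ hy ↦ (hasDerivAt_harmWeight κ hy).continuousAt.continuousWithinAt

include hf in
/-- `m f` is continuous on `(0, 2π)`. [folklore] -/
theorem continuousOn_harmWeight_mul : ContinuousOn (fun u ↦ harmWeight κ u * f u) (Ioo 0 (2 * Real.pi)) :=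
  (continuousOn_harmWeight κ).mul hf

/-- `π ∈ (0, 2π)`. [folklore] -/
theorem pi_mem_Ioo : Real.pi ∈ Ioo 0 (2 * Real.pi) := ⟨Real.pi_pos, by linarith [Real.pi_pos]⟩

/-- A closed interval between `π` and a point of `(0, 2π)` lies in `(0, 2π)`. [folklore] -/
theorem uIcc_pi_subset {y : ℝ} (hy : y ∈ Ioo 0 (2 * Real.pi)) : uIcc Real.pi y ⊆ Ioo 0 (2 * Real.pi) := by
  intro u hu
  rw [mem_uIcc] at hu
  rcases hu with h | h
  · exact ⟨lt_of_lt_of_le Real.pi_pos h.1, lt_of_le_of_lt h.2 hy.2⟩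
  · exact ⟨lt_of_lt_of_le hy.1 h.1, lt_of_le_of_lt h.2 (by linarith [Real.pi_pos])⟩

include hf in
/-- **`(flux)' = m f`** on `(0, 2π)`. [folklore] -/
theorem hasDerivAt_harmFlux {y : ℝ} (hy : y ∈ Ioo 0 (2 * Real.pi)) :
    HasDerivAt (harmFlux κ f) (harmWeight κ y * f y) y := by
  have hc := continuousOn_harmWeight_mul (κ := κ) hf
  unfold harmFlux
  refine intervalIntegral.integral_hasDerivAt_right ?_ ?_ ?_
  · exact (hc.mono (uIcc_pi_subset hy)).intervalIntegrable
  · exact hc.stronglyMeasurableAtFilter isOpen_Ioo _ hy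
  · exact hc.continuousAt (isOpen_Ioo.mem_nhds hy)

include hf in
/-- The flux is continuous on `(0, 2π)`. [folklore] -/
theorem continuousOn_harmFlux : ContinuousOn (harmFlux κ f) (Ioo 0 (2 * Real.pi)) :=
  fun _ hy ↦ (hasDerivAt_harmFlux hf hy).continuousAt.continuousWithinAt

include hf in
/-- **`(w')'`**: the derivative of `harmDeriv` on `(0, 2π)`. [folklore] -/
theorem hasDerivAt_harmDeriv {y : ℝ} (hy : y ∈ Ioo 0 (2 * Real.pi)) :
    HasDerivAt (harmDeriv κ f)
      (-(2 / κ) * ((harmWeight κ y * f y * harmWeight κ y -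
        harmFlux κ f y * (2 / κ * harmWeight κ y * Real.cot (y / 2))) / harmWeight κ y ^ 2)) y := by
  have h := (((hasDerivAt_harmFlux (κ := κ) hf hy).const_mul (-(2 / (κ : ℝ)))).div
    (hasDerivAt_harmWeight κ hy) (harmWeight_pos κ hy).ne')
  have h' := h.congr_deriv (show _ = -(2 / (κ : ℝ)) * ((harmWeight κ y * f y * harmWeight κ y -
      harmFlux κ f y * (2 / κ * harmWeight κ y * Real.cot (y / 2))) / harmWeight κ y ^ 2) by ring)
  exact h'

include hf in
/-- `w'` is continuous on `(0, 2π)`. [folklore] -/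
theorem continuousOn_harmDeriv : ContinuousOn (harmDeriv κ f) (Ioo 0 (2 * Real.pi)) :=
  fun _ hy ↦ (hasDerivAt_harmDeriv hf hy).continuousAt.continuousWithinAt

include hf in
/-- **`w' = harmDeriv`** on `(0, 2π)`. [folklore] -/
theorem hasDerivAt_harmSol {y : ℝ} (hy : y ∈ Ioo 0 (2 * Real.pi)) :
    HasDerivAt (harmSol κ f) (harmDeriv κ f y) y := by
  have hc := continuousOn_harmDeriv (κ := κ) hf
  unfold harmSol
  refine intervalIntegral.integral_hasDerivAt_right ?_ ?_ ?_
  · exact (hc.mono (uIcc_pi_subset hy)).intervalIntegrable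
  · exact hc.stronglyMeasurableAtFilter isOpen_Ioo _ hy
  · exact hc.continuousAt (isOpen_Ioo.mem_nhds hy)

include hκ in
/-- **The equation**: `(κ/2) (w')' + cot(y/2) w' = -f` on `(0, 2π)` (the terms in the flux cancel
because `m'/m = (2/κ) cot(y/2)`). [folklore] -/
theorem harmDeriv_equation {y : ℝ} (hy : y ∈ Ioo 0 (2 * Real.pi)) :
    (κ : ℝ) / 2 * (-(2 / κ) * ((harmWeight κ y * f y * harmWeight κ y -
        harmFlux κ f y * (2 / κ * harmWeight κ y * Real.cot (y / 2))) / harmWeight κ y ^ 2)) +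
      Real.cot (y / 2) * harmDeriv κ f y = -f y := by
  have hm := (harmWeight_pos κ hy).ne'
  have hκ0 : (κ : ℝ) ≠ 0 := by
    have : (4 : ℝ) < κ := by exact_mod_cast hκ
    linarith
  rw [harmDeriv]
  field_simp
  ring

include hf in
/-- **`w = harmSol κ f` is `C²` on `(0, 2π)`.** [folklore] -/
theorem contDiffOn_harmSol : ContDiffOn ℝ 2 (harmSol κ f) (Ioo 0 (2 * Real.pi)) := by
  refine contDiffOn_two_of_hasDerivAt isOpen_Ioo (fun y hy ↦ hasDerivAt_harmSol hf hy)
    (fun y hy ↦ hasDerivAt_harmDeriv (κ := κ) hf hy) ?_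
  have hm := continuousOn_harmWeight κ
  have hfl := continuousOn_harmFlux (κ := κ) hf
  have hcot : ContinuousOn (fun y : ℝ ↦ Real.cot (y / 2)) (Ioo 0 (2 * Real.pi)) := by
    intro y hy
    have hs := (sin_half_pos hy).ne'
    have : ContinuousAt (fun y : ℝ ↦ Real.cos (y / 2) / Real.sin (y / 2)) y :=
      (Real.continuous_cos.comp (continuous_id.div_const _)).continuousAt.div
        (Real.continuous_sin.comp (continuous_id.div_const _)).continuousAt hs
    refine (this.congr ?_).continuousWithinAt
    exact Eventually.of_forall fun z ↦ (Real.cot_eq_cos_div_sin _).symm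
  refine ContinuousOn.mul continuousOn_const (ContinuousOn.div ?_ (hm.pow 2)
    (fun y hy ↦ pow_ne_zero 2 (harmWeight_pos κ hy).ne'))
  exact ((hm.mul hf).mul hm).sub (hfl.mul ((continuousOn_const.mul hm).mul hcot))

include hκ hf in
/-- **`Λ₀ (harmSol κ f) = -f` on `(0, 2π)`**, with `Λ₀` the tree's `expGenerator κ 0`
(`(κ/2) ∂² + cot(·/2) ∂` in terms of `deriv`/`iteratedDeriv`). [folklore] -/
theorem expGenerator_harmSol {y : ℝ} (hy : y ∈ Ioo 0 (2 * Real.pi)) :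
    expGenerator κ 0 (harmSol κ f) y = -f y := by
  have hder : deriv (harmSol κ f) =ᶠ[𝓝 y] harmDeriv κ f := by
    filter_upwards [isOpen_Ioo.mem_nhds hy] with z hz
    exact (hasDerivAt_harmSol hf hz).deriv
  rw [expGenerator_apply, iteratedDeriv_succ, iteratedDeriv_one, hder.deriv_eq,
    (hasDerivAt_harmDeriv hf hy).deriv, (hasDerivAt_harmSol hf hy).deriv, zero_mul, add_zero]
  exact harmDeriv_equation hκ hy

end Calculus

/-! ### Dynkin's formula at the exit time of a sub-interval, in the limit `t → ∞` -/

section DynkinLimit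

variable (hκ : 4 < κ) {α β : ℝ} (hα : 2 * level n ≤ α) (hβ : β ≤ 2 * Real.pi - 2 * level n)
  (hθ : θ ∈ Ioo α β)
include hκ hα hβ hθ

/-- **Dynkin's formula at the exit time `τ` from `(α, β)`**: for `F ∈ C²(ℝ)`,
`E[F(Y_τ)] = F(θ) + E[∫₀^τ (Λ₀F)(Y_s) ds]` (`t → ∞` in `integral_apply_stoppedProcess_eq`:
`Y_{t∧τ} → Y_τ` a.s. with `F` bounded on `[α, β]`, and `∫₀^{t∧τ} → ∫₀^τ` dominated by `C τ`, which is
integrable). Lawler (2005), Prop. 1.30. [cite: Lawler2005, §1.11 Prop. 1.30] -/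
theorem integral_apply_stoppedValue_subExit_eq {F : ℝ → ℝ} (hF : ContDiff ℝ 2 F) :
    ∫ ω, F (stoppedValue (sleArgLevel κ n θ) (Process.exitTime (sleArgLevel κ n θ) α β) ω) ∂preWienerMeasure =
      F θ + ∫ ω, (∫ s in (0 : ℝ)..(((Process.exitTime (sleArgLevel κ n θ) α β ω).untopA : ℝ≥0) : ℝ),
        expGenerator κ 0 F (sleArgLevel κ n θ s.toNNReal ω)) ∂preWienerMeasure := by
  haveI := isProbabilityMeasure_preWienerMeasure'
  have hθn : θ ∈ Ioo (2 * level n) (2 * Real.pi - 2 * level n) :=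
    ⟨lt_of_le_of_lt hα hθ.1, lt_of_lt_of_le hθ.2 hβ⟩
  have hτ := isStoppingTime_subExit (κ := κ) (n := n) (θ := θ) α β
  have hτσ := subExit_le_sleExitLevel (κ := κ) (n := n) (θ := θ) hα hβ
  have hfin : ∀ᵐ ω ∂preWienerMeasure, Process.exitTime (sleArgLevel κ n θ) α β ω ≠ ⊤ :=
    ae_ne_top_of_le_sleExitLevel hκ hτσ
  have hdyn : ∀ k : ℕ, ∫ ω, F (stoppedProcess (sleArgLevel κ n θ) (Process.exitTime (sleArgLevel κ n θ) α β) k ω)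
      ∂preWienerMeasure = F θ + ∫ ω, (∫ s in (0 : ℝ)..(((min ((k : ℝ≥0) : WithTop ℝ≥0)
        (Process.exitTime (sleArgLevel κ n θ) α β ω)).untopA : ℝ≥0) : ℝ),
        expGenerator κ 0 F (sleArgLevel κ n θ s.toNNReal ω)) ∂preWienerMeasure := fun k ↦
    integral_apply_stoppedProcess_eq hθn hF hτ hτσ k
  -- left side: bounded convergence
  obtain ⟨C, hC⟩ := (isCompact_Icc (a := α) (b := β)).exists_bound_of_continuousOn hF.continuous.continuousOn
  have hlimL : ∀ᵐ ω ∂preWienerMeasure, Tendsto (fun k : ℕ ↦ F (stoppedProcess (sleArgLevel κ n θ)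
      (Process.exitTime (sleArgLevel κ n θ) α β) k ω)) atTop
      (𝓝 (F (stoppedValue (sleArgLevel κ n θ) (Process.exitTime (sleArgLevel κ n θ) α β) ω))) := by
    filter_upwards [hfin] with ω hω
    obtain ⟨T, hT⟩ := WithTop.ne_top_iff_exists.1 hω
    refine tendsto_const_nhds.congr' ?_
    obtain ⟨N, hN⟩ := exists_nat_ge (T : ℝ)
    filter_upwards [eventually_ge_atTop N] with k hk
    have hTk : (T : ℝ≥0) ≤ (k : ℝ≥0) := by
      rw [← NNReal.coe_le_coe]; push_cast; exact hN.trans (by exact_mod_cast hk)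
    rw [stoppedProcess_eq_of_ge (by rw [← hT]; exact_mod_cast hTk), stoppedValue, ← hT]
  have hmeasL : ∀ k : ℕ, AEStronglyMeasurable (fun ω ↦ F (stoppedProcess (sleArgLevel κ n θ)
      (Process.exitTime (sleArgLevel κ n θ) α β) k ω)) preWienerMeasure := fun k ↦
    (hF.continuous.measurable.comp ((stronglyAdapted_stoppedProcess_sleArgLevel κ n θ hτ k).measurable.mono
      (brownianFiltration.le _) le_rfl)).aestronglyMeasurable
  have hboundL : ∀ k : ℕ, ∀ᵐ ω ∂preWienerMeasure, ‖F (stoppedProcess (sleArgLevel κ n θ)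
      (Process.exitTime (sleArgLevel κ n θ) α β) k ω)‖ ≤ C := fun k ↦
    Eventually.of_forall fun ω ↦ hC _ (stoppedProcess_subExit_mem_Icc hθ k ω)
  have hdctL := tendsto_integral_of_dominated_convergence _ hmeasL (integrable_const C) hboundL hlimL
  -- right side: dominated convergence with bound `K τ`
  have hsub : Icc α β ⊆ Ioo 0 (2 * Real.pi) := fun y hy ↦ Icc_level_subset_Ioo n (Icc_subset_Icc hα hβ hy)
  obtain ⟨K, hK⟩ := (isCompact_Icc (a := α) (b := β)).exists_bound_of_continuousOn
    ((continuousOn_expGenerator κ 0 hF).mono hsub)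
  have hK0 : 0 ≤ K := (norm_nonneg _).trans (hK θ ⟨hθ.1.le, hθ.2.le⟩)
  set R : (ℝ≥0 → ℝ) → ℝ := fun ω ↦ (((Process.exitTime (sleArgLevel κ n θ) α β ω).untopA : ℝ≥0) : ℝ) with hR
  have hRi : Integrable R preWienerMeasure := integrable_untopA_of_le_sleExitLevel hκ hτ hτσ
  have hgval : ∀ ω, ∀ s ∈ Icc (0 : ℝ) (R ω), (Process.exitTime (sleArgLevel κ n θ) α β ω ≠ ⊤) →
      ‖expGenerator κ 0 F (sleArgLevel κ n θ s.toNNReal ω)‖ ≤ K := by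
    intro ω s hs hne
    obtain ⟨T, hT⟩ := WithTop.ne_top_iff_exists.1 hne
    have hsT : ((s.toNNReal : ℝ≥0) : WithTop ℝ≥0) ≤ Process.exitTime (sleArgLevel κ n θ) α β ω := by
      rw [← hT, WithTop.coe_le_coe]
      have : R ω = T := coe_untopA_of_eq_coe hT.symm
      rw [this] at hs
      exact (Real.toNNReal_le_iff_le_coe).2 hs.2
    have hmem : sleArgLevel κ n θ s.toNNReal ω ∈ Icc α β := by
      have := stoppedProcess_subExit_mem_Icc (κ := κ) (n := n) hθ s.toNNReal ω
      rwa [stoppedProcess_eq_of_le hsT] at this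
    exact hK _ hmem
  have hlimR : ∀ᵐ ω ∂preWienerMeasure, Tendsto (fun k : ℕ ↦ ∫ s in (0 : ℝ)..(((min ((k : ℝ≥0) : WithTop ℝ≥0)
      (Process.exitTime (sleArgLevel κ n θ) α β ω)).untopA : ℝ≥0) : ℝ),
      expGenerator κ 0 F (sleArgLevel κ n θ s.toNNReal ω)) atTop
      (𝓝 (∫ s in (0 : ℝ)..R ω, expGenerator κ 0 F (sleArgLevel κ n θ s.toNNReal ω))) := by
    filter_upwards [hfin] with ω hω
    obtain ⟨T, hT⟩ := WithTop.ne_top_iff_exists.1 hω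
    refine tendsto_const_nhds.congr' ?_
    obtain ⟨N, hN⟩ := exists_nat_ge (T : ℝ)
    filter_upwards [eventually_ge_atTop N] with k hk
    have hTk : (T : ℝ≥0) ≤ (k : ℝ≥0) := by
      rw [← NNReal.coe_le_coe]; push_cast; exact hN.trans (by exact_mod_cast hk)
    have : min ((k : ℝ≥0) : WithTop ℝ≥0) (Process.exitTime (sleArgLevel κ n θ) α β ω) =
        Process.exitTime (sleArgLevel κ n θ) α β ω := min_eq_right (by rw [← hT]; exact_mod_cast hTk)
    rw [this]
  have hmeasR : ∀ k : ℕ, AEStronglyMeasurable (fun ω ↦ ∫ s in (0 : ℝ)..(((min ((k : ℝ≥0) : WithTop ℝ≥0)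
      (Process.exitTime (sleArgLevel κ n θ) α β ω)).untopA : ℝ≥0) : ℝ),
      expGenerator κ 0 F (sleArgLevel κ n θ s.toNNReal ω)) preWienerMeasure := fun k ↦
    (integrable_intervalIntegral_expGenerator hθn hF hτ hτσ k).aestronglyMeasurable
  have hboundR : ∀ k : ℕ, ∀ᵐ ω ∂preWienerMeasure, ‖∫ s in (0 : ℝ)..(((min ((k : ℝ≥0) : WithTop ℝ≥0)
      (Process.exitTime (sleArgLevel κ n θ) α β ω)).untopA : ℝ≥0) : ℝ),
      expGenerator κ 0 F (sleArgLevel κ n θ s.toNNReal ω)‖ ≤ K * |R ω| := by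
    intro k
    filter_upwards [hfin] with ω hω
    have hr0 : 0 ≤ (((min ((k : ℝ≥0) : WithTop ℝ≥0)
        (Process.exitTime (sleArgLevel κ n θ) α β ω)).untopA : ℝ≥0) : ℝ) := NNReal.coe_nonneg _
    have hrR : (((min ((k : ℝ≥0) : WithTop ℝ≥0)
        (Process.exitTime (sleArgLevel κ n θ) α β ω)).untopA : ℝ≥0) : ℝ) ≤ R ω := by
      obtain ⟨T, hT⟩ := WithTop.ne_top_iff_exists.1 hω
      rw [hR]
      simp only [← hT, ← WithTop.coe_min]
      exact_mod_cast min_le_right (k : ℝ≥0) T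
    have hni := intervalIntegral.norm_integral_le_of_norm_le_const (a := (0 : ℝ)) (C := K)
      (b := (((min ((k : ℝ≥0) : WithTop ℝ≥0) (Process.exitTime (sleArgLevel κ n θ) α β ω)).untopA : ℝ≥0) : ℝ))
      (f := fun s ↦ expGenerator κ 0 F (sleArgLevel κ n θ s.toNNReal ω)) (fun s hs ↦ by
        rw [uIoc_of_le hr0] at hs
        exact hgval ω s ⟨hs.1.le, hs.2.trans hrR⟩ hω)
    rw [sub_zero] at hni
    refine hni.trans ?_
    rw [abs_of_nonneg hr0, abs_of_nonneg (NNReal.coe_nonneg _)]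
    exact mul_le_mul_of_nonneg_left hrR hK0
  have hdctR := tendsto_integral_of_dominated_convergence _ hmeasR (hRi.abs.const_mul K) hboundR hlimR
  have h := tendsto_nhds_unique hdctL ((tendsto_const_nhds.add hdctR).congr fun k ↦ (hdyn k).symm)
  exact h

end DynkinLimit

/-! ### The exit functionals solve the equation -/

section Regularity

variable (hκ : 4 < κ) {ψ ψ' : ℝ → ℝ} (hψ : ∀ t, HasDerivAt ψ (ψ' t) t) (hψ'c : Continuous ψ')
  {C C' : ℝ} (hψb : ∀ t, |ψ t| ≤ C) (hψ'b : ∀ t, |ψ' t| ≤ C')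
include hκ hψ hψ'c hψb hψ'b

/-- **`a_ψ` is the particular solution plus an affine function of the scale function** on every
short interval: for `[θ₁, θ₂]` in the level-`n` interval and `θ ∈ (θ₁, θ₂)`,
`a_ψ(θ) = w(θ) + ((a_ψ - w)(θ₁) (s(θ₂) - s(θ)) + (a_ψ - w)(θ₂) (s(θ) - s(θ₁)))/(s(θ₂) - s(θ₁))`,
`w = harmSol κ a_{ψ'}`, `s = sleScale κ`. Proof: Dynkin's formula at the exit time `τ` of `(θ₁, θ₂)`
for a `C²` extension of `w` (`Λ₀ w = -a_{ψ'}`) and the Dynkin identity for `a_ψ`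
(`integral_intervalIntegral_topExpect_eq`) give `(a_ψ - w)(θ) = E[(a_ψ - w)(Y_τ)]`, and `Y_τ ∈ {θ₁, θ₂}`
with `P[Y_τ = θ₁] = (s(θ₂) - s(θ))/(s(θ₂) - s(θ₁))`. [cite: LawlerSchrammWernerEJP2002, §2 proof of Lemma 2.2] -/
theorem topExpect_eq_harmSol_add {θ₁ θ₂ : ℝ} (hθ₁ : 2 * level n ≤ θ₁) (hθ₂ : θ₂ ≤ 2 * Real.pi - 2 * level n)
    (hθ : θ ∈ Ioo θ₁ θ₂) :
    topExpect κ ψ θ = harmSol κ (topExpect κ ψ') θ +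
      ((topExpect κ ψ θ₁ - harmSol κ (topExpect κ ψ') θ₁) * (sleScale κ θ₂ - sleScale κ θ) +
        (topExpect κ ψ θ₂ - harmSol κ (topExpect κ ψ') θ₂) * (sleScale κ θ - sleScale κ θ₁)) /
        (sleScale κ θ₂ - sleScale κ θ₁) := by
  haveI := isProbabilityMeasure_preWienerMeasure'
  have hθn : θ ∈ Ioo (2 * level n) (2 * Real.pi - 2 * level n) :=
    ⟨lt_of_le_of_lt hθ₁ hθ.1, lt_of_lt_of_le hθ.2 hθ₂⟩
  set a := topExpect κ ψ with ha
  set a₁ := topExpect κ ψ' with ha₁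
  have ha₁c : ContinuousOn a₁ (Ioo 0 (2 * Real.pi)) := continuousOn_topExpect hκ hψ'c hψ'b
  -- a global `C²` function agreeing with `w` near the level interval
  obtain ⟨F, hF, hFeq⟩ := exists_contDiff_eventuallyEq (contDiffOn_harmSol ha₁c) (level_pos n) (level_lt_pi n)
  have hIcc : Icc θ₁ θ₂ ⊆ Icc (2 * level n) (2 * Real.pi - 2 * level n) := Icc_subset_Icc hθ₁ hθ₂
  have hFval : ∀ y ∈ Icc θ₁ θ₂, F y = harmSol κ a₁ y := fun y hy ↦
    (hFeq y (Icc_level_subset_Ioo_level n (hIcc hy))).eq_of_nhds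
  have hgen : ∀ y ∈ Icc θ₁ θ₂, expGenerator κ 0 F y = -a₁ y := by
    intro y hy
    rw [expGenerator_congr (hFeq y (Icc_level_subset_Ioo_level n (hIcc hy)))]
    exact expGenerator_harmSol hκ ha₁c (Icc_level_subset_Ioo n (hIcc hy))
  have hτ := isStoppingTime_subExit (κ := κ) (n := n) (θ := θ) θ₁ θ₂
  have hτσ := subExit_le_sleExitLevel (κ := κ) (n := n) (θ := θ) hθ₁ hθ₂
  have hfin : ∀ᵐ ω ∂preWienerMeasure, Process.exitTime (sleArgLevel κ n θ) θ₁ θ₂ ω ≠ ⊤ :=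
    ae_ne_top_of_le_sleExitLevel hκ hτσ
  -- (W): Dynkin for `F` at `τ`
  have hW := integral_apply_stoppedValue_subExit_eq (n := n) hκ hθ₁ hθ₂ hθ hF
  have hWint : ∫ ω, (∫ s in (0 : ℝ)..(((Process.exitTime (sleArgLevel κ n θ) θ₁ θ₂ ω).untopA : ℝ≥0) : ℝ),
      expGenerator κ 0 F (sleArgLevel κ n θ s.toNNReal ω)) ∂preWienerMeasure =
      -∫ ω, (∫ s in (0 : ℝ)..(((Process.exitTime (sleArgLevel κ n θ) θ₁ θ₂ ω).untopA : ℝ≥0) : ℝ),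
        a₁ (sleArgLevel κ n θ s.toNNReal ω)) ∂preWienerMeasure := by
    rw [← integral_neg]
    refine integral_congr_ae ?_
    filter_upwards [hfin] with ω hω
    rw [← intervalIntegral.integral_neg]
    refine intervalIntegral.integral_congr fun s hs ↦ ?_
    obtain ⟨T, hT⟩ := WithTop.ne_top_iff_exists.1 hω
    rw [uIcc_of_le (NNReal.coe_nonneg _), coe_untopA_of_eq_coe hT.symm] at hs
    have hsT : ((s.toNNReal : ℝ≥0) : WithTop ℝ≥0) ≤ Process.exitTime (sleArgLevel κ n θ) θ₁ θ₂ ω := by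
      rw [← hT, WithTop.coe_le_coe]; exact (Real.toNNReal_le_iff_le_coe).2 hs.2
    have hmem : sleArgLevel κ n θ s.toNNReal ω ∈ Icc θ₁ θ₂ := by
      have := stoppedProcess_subExit_mem_Icc (κ := κ) (n := n) hθ s.toNNReal ω
      rwa [stoppedProcess_eq_of_le hsT] at this
    exact hgen _ hmem
  -- (A): the Dynkin identity for `a`
  have hA := integral_intervalIntegral_topExpect_eq hκ hθn hτ hτσ hψ hψ'c hψb hψ'b
  -- the two-point formula for `g = a - F`
  have h2 := integral_comp_stoppedValue_subExit hκ hθ₁ hθ₂ hθ (fun y ↦ a y - F y)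
  have hP := measureReal_stoppedValue_subExit_eq_mul hκ hθ₁ hθ₂ hθ
  set p := preWienerMeasure.real {ω | stoppedValue (sleArgLevel κ n θ)
    (Process.exitTime (sleArgLevel κ n θ) θ₁ θ₂) ω = θ₁} with hp
  -- integrability of `a(Y_τ)` and `F(Y_τ)`
  have hmsv := measurable_stoppedValue_subExit (κ := κ) (n := n) (θ := θ) θ₁ θ₂
  have hai : Integrable (fun ω ↦ a (stoppedValue (sleArgLevel κ n θ)
      (Process.exitTime (sleArgLevel κ n θ) θ₁ θ₂) ω)) preWienerMeasure :=
    integrable_of_abs_le ((measurable_topExpect κ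
      (continuous_iff_continuousAt.2 fun t ↦ (hψ t).continuousAt).measurable).comp hmsv)
      fun ω ↦ abs_topExpect_le κ hψb _
  obtain ⟨CF, hCF⟩ := (isCompact_Icc (a := θ₁) (b := θ₂)).exists_bound_of_continuousOn hF.continuous.continuousOn
  have hFi : Integrable (fun ω ↦ F (stoppedValue (sleArgLevel κ n θ)
      (Process.exitTime (sleArgLevel κ n θ) θ₁ θ₂) ω)) preWienerMeasure := by
    refine (integrable_const CF).mono' ((hF.continuous.measurable.comp hmsv).aestronglyMeasurable) ?_
    filter_upwards [ae_stoppedValue_subExit_eq_or hκ hθ₁ hθ₂ hθ] with ω hω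
    rcases hω with h | h <;> rw [h]
    · exact hCF _ ⟨le_rfl, (hθ.1.trans hθ.2).le⟩
    · exact hCF _ ⟨(hθ.1.trans hθ.2).le, le_rfl⟩
  have hsub : ∫ ω, (a (stoppedValue (sleArgLevel κ n θ) (Process.exitTime (sleArgLevel κ n θ) θ₁ θ₂) ω) -
      F (stoppedValue (sleArgLevel κ n θ) (Process.exitTime (sleArgLevel κ n θ) θ₁ θ₂) ω)) ∂preWienerMeasure =
      (∫ ω, a (stoppedValue (sleArgLevel κ n θ) (Process.exitTime (sleArgLevel κ n θ) θ₁ θ₂) ω) ∂preWienerMeasure) -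
      ∫ ω, F (stoppedValue (sleArgLevel κ n θ) (Process.exitTime (sleArgLevel κ n θ) θ₁ θ₂) ω) ∂preWienerMeasure :=
    integral_sub hai hFi
  -- combine: `(a - F)(θ) = E[(a - F)(Y_τ)]`
  have hkey : a θ - F θ = ∫ ω, (a (stoppedValue (sleArgLevel κ n θ) (Process.exitTime (sleArgLevel κ n θ) θ₁ θ₂) ω) -
      F (stoppedValue (sleArgLevel κ n θ) (Process.exitTime (sleArgLevel κ n θ) θ₁ θ₂) ω)) ∂preWienerMeasure := by
    rw [hsub, hW, hWint]
    linarith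
  rw [h2] at hkey
  -- solve for `a θ`
  have hθIcc : θ ∈ Icc 0 (2 * Real.pi) :=
    ⟨(Icc_level_subset_Ioo n (hIcc ⟨hθ.1.le, hθ.2.le⟩)).1.le, (Icc_level_subset_Ioo n (hIcc ⟨hθ.1.le, hθ.2.le⟩)).2.le⟩
  have h1Icc : θ₁ ∈ Icc 0 (2 * Real.pi) :=
    ⟨(Icc_level_subset_Ioo n (hIcc ⟨le_rfl, (hθ.1.trans hθ.2).le⟩)).1.le,
      (Icc_level_subset_Ioo n (hIcc ⟨le_rfl, (hθ.1.trans hθ.2).le⟩)).2.le⟩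
  have h2Icc : θ₂ ∈ Icc 0 (2 * Real.pi) :=
    ⟨(Icc_level_subset_Ioo n (hIcc ⟨(hθ.1.trans hθ.2).le, le_rfl⟩)).1.le,
      (Icc_level_subset_Ioo n (hIcc ⟨(hθ.1.trans hθ.2).le, le_rfl⟩)).2.le⟩
  have hs12 : 0 < sleScale κ θ₂ - sleScale κ θ₁ :=
    sub_pos.2 (strictMonoOn_sleScale hκ h1Icc h2Icc (hθ.1.trans hθ.2))
  have hpeq : p = (sleScale κ θ₂ - sleScale κ θ) / (sleScale κ θ₂ - sleScale κ θ₁) := by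
    rw [eq_div_iff hs12.ne']; exact hP
  rw [hFval θ ⟨hθ.1.le, hθ.2.le⟩, hFval θ₁ ⟨le_rfl, (hθ.1.trans hθ.2).le⟩,
    hFval θ₂ ⟨(hθ.1.trans hθ.2).le, le_rfl⟩, hpeq] at hkey
  have hD : sleScale κ θ₂ - sleScale κ θ₁ ≠ 0 := hs12.ne'
  have hstep : a θ = harmSol κ a₁ θ + ((a θ₁ - harmSol κ a₁ θ₁) *
      ((sleScale κ θ₂ - sleScale κ θ) / (sleScale κ θ₂ - sleScale κ θ₁)) +
      (a θ₂ - harmSol κ a₁ θ₂) * (1 - (sleScale κ θ₂ - sleScale κ θ) / (sleScale κ θ₂ - sleScale κ θ₁))) := by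
    linarith
  rw [hstep]
  field_simp
  ring

/-- **`a_ψ` is `C²` at every point of `(0, 2π)`** (LSW's Lemma 2.2, space regularity).
[cite: LawlerSchrammWernerEJP2002, §2 Lemma 2.2] -/
theorem contDiffAt_topExpect (hθ : θ ∈ Ioo 0 (2 * Real.pi)) : ContDiffAt ℝ 2 (topExpect κ ψ) θ := by
  obtain ⟨N, hN⟩ := eventually_mem_Ioo_level hθ
  have hθn := hN N le_rfl
  -- a short interval around `θ` inside the level-`N` interval
  set η := min (θ - 2 * level N) (2 * Real.pi - 2 * level N - θ) / 2 with hη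
  have hη0 : 0 < η := by
    have := lt_min (sub_pos.2 hθn.1) (by linarith [hθn.2] : 0 < 2 * Real.pi - 2 * level N - θ)
    rw [hη]; linarith
  have hθ₁ : 2 * level N ≤ θ - η := by
    have := min_le_left (θ - 2 * level N) (2 * Real.pi - 2 * level N - θ); rw [hη]; linarith
  have hθ₂ : θ + η ≤ 2 * Real.pi - 2 * level N := by
    have := min_le_right (θ - 2 * level N) (2 * Real.pi - 2 * level N - θ); rw [hη]; linarith
  have ha₁c : ContinuousOn (topExpect κ ψ') (Ioo 0 (2 * Real.pi)) := continuousOn_topExpect hκ hψ'c hψ'b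
  -- the explicit `C²` function
  set Φ : ℝ → ℝ := fun y ↦ harmSol κ (topExpect κ ψ') y +
    ((topExpect κ ψ (θ - η) - harmSol κ (topExpect κ ψ') (θ - η)) * (sleScale κ (θ + η) - sleScale κ y) +
      (topExpect κ ψ (θ + η) - harmSol κ (topExpect κ ψ') (θ + η)) * (sleScale κ y - sleScale κ (θ - η))) /
      (sleScale κ (θ + η) - sleScale κ (θ - η)) with hΦ
  have heq : topExpect κ ψ =ᶠ[𝓝 θ] Φ := by
    filter_upwards [Ioo_mem_nhds (show θ - η < θ by linarith) (show θ < θ + η by linarith)] with y hy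
    exact topExpect_eq_harmSol_add (n := N) hκ hψ hψ'c hψb hψ'b hθ₁ hθ₂ hy
  have hsC : ContDiffOn ℝ 2 (sleScale κ) (Ioo 0 (2 * Real.pi)) := contDiffOn_sleScale hκ
  have hΦc : ContDiffOn ℝ 2 Φ (Ioo 0 (2 * Real.pi)) := by
    refine (contDiffOn_harmSol ha₁c).add (ContDiffOn.div_const (ContDiffOn.add ?_ ?_) _)
    · exact contDiffOn_const.mul (contDiffOn_const.sub hsC)
    · exact contDiffOn_const.mul (hsC.sub contDiffOn_const)
  exact ((hΦc.contDiffAt (isOpen_Ioo.mem_nhds hθ)).congr_of_eventuallyEq heq)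

/-- **LSW's equation (2.4) in the space variable for `a_ψ`**:
`(κ/2) a_ψ'' + cot(θ/2) a_ψ' = -a_{ψ'}` on `(0, 2π)`, with the tree's `expGenerator κ 0`.
[cite: LawlerSchrammWernerEJP2002, §2 Lemma 2.2 (2.4)] -/
theorem expGenerator_topExpect_eq (hθ : θ ∈ Ioo 0 (2 * Real.pi)) :
    expGenerator κ 0 (topExpect κ ψ) θ = -topExpect κ ψ' θ := by
  obtain ⟨N, hN⟩ := eventually_mem_Ioo_level hθ
  have hθn := hN N le_rfl
  set η := min (θ - 2 * level N) (2 * Real.pi - 2 * level N - θ) / 2 with hη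
  have hη0 : 0 < η := by
    have := lt_min (sub_pos.2 hθn.1) (by linarith [hθn.2] : 0 < 2 * Real.pi - 2 * level N - θ)
    rw [hη]; linarith
  have hθ₁ : 2 * level N ≤ θ - η := by
    have := min_le_left (θ - 2 * level N) (2 * Real.pi - 2 * level N - θ); rw [hη]; linarith
  have hθ₂ : θ + η ≤ 2 * Real.pi - 2 * level N := by
    have := min_le_right (θ - 2 * level N) (2 * Real.pi - 2 * level N - θ); rw [hη]; linarith
  have ha₁c : ContinuousOn (topExpect κ ψ') (Ioo 0 (2 * Real.pi)) := continuousOn_topExpect hκ hψ'c hψ'b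
  set k₁ := topExpect κ ψ (θ - η) - harmSol κ (topExpect κ ψ') (θ - η) with hk₁
  set k₂ := topExpect κ ψ (θ + η) - harmSol κ (topExpect κ ψ') (θ + η) with hk₂
  set D := sleScale κ (θ + η) - sleScale κ (θ - η) with hD
  set Φ : ℝ → ℝ := fun y ↦ harmSol κ (topExpect κ ψ') y +
    (k₁ * (sleScale κ (θ + η) - sleScale κ y) + k₂ * (sleScale κ y - sleScale κ (θ - η))) / D with hΦ
  have heq : topExpect κ ψ =ᶠ[𝓝 θ] Φ := by
    filter_upwards [Ioo_mem_nhds (show θ - η < θ by linarith) (show θ < θ + η by linarith)] with y hy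
    exact topExpect_eq_harmSol_add (n := N) hκ hψ hψ'c hψb hψ'b hθ₁ hθ₂ hy
  rw [expGenerator_congr heq]
  -- `Φ = w + (c₀ + c₁ s)` with `Λ₀ w = -a_{ψ'}` and `Λ₀ (c₀ + c₁ s) = c₁ Λ₀ s = 0`
  set c₀ := (k₁ * sleScale κ (θ + η) - k₂ * sleScale κ (θ - η)) / D with hc₀
  set c₁ := (k₂ - k₁) / D with hc₁
  have hΦ' : Φ = fun y ↦ harmSol κ (topExpect κ ψ') y + (c₀ + c₁ * sleScale κ y) := by
    funext y; simp only [hΦ, hc₀, hc₁]; ring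
  rw [hΦ']
  have hw2 : ContDiffOn ℝ 2 (harmSol κ (topExpect κ ψ')) (Ioo 0 (2 * Real.pi)) := contDiffOn_harmSol ha₁c
  have hq2 : ContDiffOn ℝ 2 (fun y ↦ c₀ + c₁ * sleScale κ y) (Ioo 0 (2 * Real.pi)) :=
    contDiffOn_const.add (contDiffOn_const.mul (contDiffOn_sleScale hκ))
  rw [expGenerator_add_of_contDiffOn isOpen_Ioo hw2 hq2 hθ, expGenerator_harmSol hκ ha₁c hθ,
    expGenerator_const_add, expGenerator_const_mul, expGenerator_sleScale hκ hθ]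
  ring

/-- **`b_ψ` is the particular solution plus an affine function of the scale function** on every
short interval: for `[θ₁, θ₂]` in the level-`n` interval and `θ ∈ (θ₁, θ₂)`,
`b_ψ(θ) = w(θ) + ((b_ψ - w)(θ₁) (s(θ₂) - s(θ)) + (b_ψ - w)(θ₂) (s(θ) - s(θ₁)))/(s(θ₂) - s(θ₁))`,
`w = harmSol κ b_{ψ'}`, `s = sleScale κ`. Proof: Dynkin's formula at the exit time `τ` of `(θ₁, θ₂)`
for a `C²` extension of `w` (`Λ₀ w = -b_{ψ'}`) and the Dynkin identity for `b_ψ`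
(`integral_intervalIntegral_botExpect_eq`) give `(b_ψ - w)(θ) = E[(b_ψ - w)(Y_τ)]`, and `Y_τ ∈ {θ₁, θ₂}`
with `P[Y_τ = θ₁] = (s(θ₂) - s(θ))/(s(θ₂) - s(θ₁))`. [cite: LawlerSchrammWernerEJP2002, §2 proof of Lemma 2.2] -/
theorem botExpect_eq_harmSol_add {θ₁ θ₂ : ℝ} (hθ₁ : 2 * level n ≤ θ₁) (hθ₂ : θ₂ ≤ 2 * Real.pi - 2 * level n)
    (hθ : θ ∈ Ioo θ₁ θ₂) :
    botExpect κ ψ θ = harmSol κ (botExpect κ ψ') θ +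
      ((botExpect κ ψ θ₁ - harmSol κ (botExpect κ ψ') θ₁) * (sleScale κ θ₂ - sleScale κ θ) +
        (botExpect κ ψ θ₂ - harmSol κ (botExpect κ ψ') θ₂) * (sleScale κ θ - sleScale κ θ₁)) /
        (sleScale κ θ₂ - sleScale κ θ₁) := by
  haveI := isProbabilityMeasure_preWienerMeasure'
  have hθn : θ ∈ Ioo (2 * level n) (2 * Real.pi - 2 * level n) :=
    ⟨lt_of_le_of_lt hθ₁ hθ.1, lt_of_lt_of_le hθ.2 hθ₂⟩
  set a := botExpect κ ψ with ha
  set a₁ := botExpect κ ψ' with ha₁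
  have ha₁c : ContinuousOn a₁ (Ioo 0 (2 * Real.pi)) := continuousOn_botExpect hκ hψ'c hψ'b
  -- a global `C²` function agreeing with `w` near the level interval
  obtain ⟨F, hF, hFeq⟩ := exists_contDiff_eventuallyEq (contDiffOn_harmSol ha₁c) (level_pos n) (level_lt_pi n)
  have hIcc : Icc θ₁ θ₂ ⊆ Icc (2 * level n) (2 * Real.pi - 2 * level n) := Icc_subset_Icc hθ₁ hθ₂
  have hFval : ∀ y ∈ Icc θ₁ θ₂, F y = harmSol κ a₁ y := fun y hy ↦
    (hFeq y (Icc_level_subset_Ioo_level n (hIcc hy))).eq_of_nhds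
  have hgen : ∀ y ∈ Icc θ₁ θ₂, expGenerator κ 0 F y = -a₁ y := by
    intro y hy
    rw [expGenerator_congr (hFeq y (Icc_level_subset_Ioo_level n (hIcc hy)))]
    exact expGenerator_harmSol hκ ha₁c (Icc_level_subset_Ioo n (hIcc hy))
  have hτ := isStoppingTime_subExit (κ := κ) (n := n) (θ := θ) θ₁ θ₂
  have hτσ := subExit_le_sleExitLevel (κ := κ) (n := n) (θ := θ) hθ₁ hθ₂
  have hfin : ∀ᵐ ω ∂preWienerMeasure, Process.exitTime (sleArgLevel κ n θ) θ₁ θ₂ ω ≠ ⊤ :=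
    ae_ne_top_of_le_sleExitLevel hκ hτσ
  -- (W): Dynkin for `F` at `τ`
  have hW := integral_apply_stoppedValue_subExit_eq (n := n) hκ hθ₁ hθ₂ hθ hF
  have hWint : ∫ ω, (∫ s in (0 : ℝ)..(((Process.exitTime (sleArgLevel κ n θ) θ₁ θ₂ ω).untopA : ℝ≥0) : ℝ),
      expGenerator κ 0 F (sleArgLevel κ n θ s.toNNReal ω)) ∂preWienerMeasure =
      -∫ ω, (∫ s in (0 : ℝ)..(((Process.exitTime (sleArgLevel κ n θ) θ₁ θ₂ ω).untopA : ℝ≥0) : ℝ),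
        a₁ (sleArgLevel κ n θ s.toNNReal ω)) ∂preWienerMeasure := by
    rw [← integral_neg]
    refine integral_congr_ae ?_
    filter_upwards [hfin] with ω hω
    rw [← intervalIntegral.integral_neg]
    refine intervalIntegral.integral_congr fun s hs ↦ ?_
    obtain ⟨T, hT⟩ := WithTop.ne_top_iff_exists.1 hω
    rw [uIcc_of_le (NNReal.coe_nonneg _), coe_untopA_of_eq_coe hT.symm] at hs
    have hsT : ((s.toNNReal : ℝ≥0) : WithTop ℝ≥0) ≤ Process.exitTime (sleArgLevel κ n θ) θ₁ θ₂ ω := by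
      rw [← hT, WithTop.coe_le_coe]; exact (Real.toNNReal_le_iff_le_coe).2 hs.2
    have hmem : sleArgLevel κ n θ s.toNNReal ω ∈ Icc θ₁ θ₂ := by
      have := stoppedProcess_subExit_mem_Icc (κ := κ) (n := n) hθ s.toNNReal ω
      rwa [stoppedProcess_eq_of_le hsT] at this
    exact hgen _ hmem
  -- (A): the Dynkin identity for `a`
  have hA := integral_intervalIntegral_botExpect_eq hκ hθn hτ hτσ hψ hψ'c hψb hψ'b
  -- the two-point formula for `g = a - F`
  have h2 := integral_comp_stoppedValue_subExit hκ hθ₁ hθ₂ hθ (fun y ↦ a y - F y)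
  have hP := measureReal_stoppedValue_subExit_eq_mul hκ hθ₁ hθ₂ hθ
  set p := preWienerMeasure.real {ω | stoppedValue (sleArgLevel κ n θ)
    (Process.exitTime (sleArgLevel κ n θ) θ₁ θ₂) ω = θ₁} with hp
  -- integrability of `a(Y_τ)` and `F(Y_τ)`
  have hmsv := measurable_stoppedValue_subExit (κ := κ) (n := n) (θ := θ) θ₁ θ₂
  have hai : Integrable (fun ω ↦ a (stoppedValue (sleArgLevel κ n θ)
      (Process.exitTime (sleArgLevel κ n θ) θ₁ θ₂) ω)) preWienerMeasure :=
    integrable_of_abs_le ((measurable_botExpect κ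
      (continuous_iff_continuousAt.2 fun t ↦ (hψ t).continuousAt).measurable).comp hmsv)
      fun ω ↦ abs_botExpect_le κ hψb _
  obtain ⟨CF, hCF⟩ := (isCompact_Icc (a := θ₁) (b := θ₂)).exists_bound_of_continuousOn hF.continuous.continuousOn
  have hFi : Integrable (fun ω ↦ F (stoppedValue (sleArgLevel κ n θ)
      (Process.exitTime (sleArgLevel κ n θ) θ₁ θ₂) ω)) preWienerMeasure := by
    refine (integrable_const CF).mono' ((hF.continuous.measurable.comp hmsv).aestronglyMeasurable) ?_
    filter_upwards [ae_stoppedValue_subExit_eq_or hκ hθ₁ hθ₂ hθ] with ω hω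
    rcases hω with h | h <;> rw [h]
    · exact hCF _ ⟨le_rfl, (hθ.1.trans hθ.2).le⟩
    · exact hCF _ ⟨(hθ.1.trans hθ.2).le, le_rfl⟩
  have hsub : ∫ ω, (a (stoppedValue (sleArgLevel κ n θ) (Process.exitTime (sleArgLevel κ n θ) θ₁ θ₂) ω) -
      F (stoppedValue (sleArgLevel κ n θ) (Process.exitTime (sleArgLevel κ n θ) θ₁ θ₂) ω)) ∂preWienerMeasure =
      (∫ ω, a (stoppedValue (sleArgLevel κ n θ) (Process.exitTime (sleArgLevel κ n θ) θ₁ θ₂) ω) ∂preWienerMeasure) -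
      ∫ ω, F (stoppedValue (sleArgLevel κ n θ) (Process.exitTime (sleArgLevel κ n θ) θ₁ θ₂) ω) ∂preWienerMeasure :=
    integral_sub hai hFi
  -- combine: `(a - F)(θ) = E[(a - F)(Y_τ)]`
  have hkey : a θ - F θ = ∫ ω, (a (stoppedValue (sleArgLevel κ n θ) (Process.exitTime (sleArgLevel κ n θ) θ₁ θ₂) ω) -
      F (stoppedValue (sleArgLevel κ n θ) (Process.exitTime (sleArgLevel κ n θ) θ₁ θ₂) ω)) ∂preWienerMeasure := by
    rw [hsub, hW, hWint]
    linarith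
  rw [h2] at hkey
  -- solve for `a θ`
  have hθIcc : θ ∈ Icc 0 (2 * Real.pi) :=
    ⟨(Icc_level_subset_Ioo n (hIcc ⟨hθ.1.le, hθ.2.le⟩)).1.le, (Icc_level_subset_Ioo n (hIcc ⟨hθ.1.le, hθ.2.le⟩)).2.le⟩
  have h1Icc : θ₁ ∈ Icc 0 (2 * Real.pi) :=
    ⟨(Icc_level_subset_Ioo n (hIcc ⟨le_rfl, (hθ.1.trans hθ.2).le⟩)).1.le,
      (Icc_level_subset_Ioo n (hIcc ⟨le_rfl, (hθ.1.trans hθ.2).le⟩)).2.le⟩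
  have h2Icc : θ₂ ∈ Icc 0 (2 * Real.pi) :=
    ⟨(Icc_level_subset_Ioo n (hIcc ⟨(hθ.1.trans hθ.2).le, le_rfl⟩)).1.le,
      (Icc_level_subset_Ioo n (hIcc ⟨(hθ.1.trans hθ.2).le, le_rfl⟩)).2.le⟩
  have hs12 : 0 < sleScale κ θ₂ - sleScale κ θ₁ :=
    sub_pos.2 (strictMonoOn_sleScale hκ h1Icc h2Icc (hθ.1.trans hθ.2))
  have hpeq : p = (sleScale κ θ₂ - sleScale κ θ) / (sleScale κ θ₂ - sleScale κ θ₁) := by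
    rw [eq_div_iff hs12.ne']; exact hP
  rw [hFval θ ⟨hθ.1.le, hθ.2.le⟩, hFval θ₁ ⟨le_rfl, (hθ.1.trans hθ.2).le⟩,
    hFval θ₂ ⟨(hθ.1.trans hθ.2).le, le_rfl⟩, hpeq] at hkey
  have hD : sleScale κ θ₂ - sleScale κ θ₁ ≠ 0 := hs12.ne'
  have hstep : a θ = harmSol κ a₁ θ + ((a θ₁ - harmSol κ a₁ θ₁) *
      ((sleScale κ θ₂ - sleScale κ θ) / (sleScale κ θ₂ - sleScale κ θ₁)) +
      (a θ₂ - harmSol κ a₁ θ₂) * (1 - (sleScale κ θ₂ - sleScale κ θ) / (sleScale κ θ₂ - sleScale κ θ₁))) := by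
    linarith
  rw [hstep]
  field_simp
  ring

/-- **`b_ψ` is `C²` at every point of `(0, 2π)`** (LSW's Lemma 2.2, space regularity).
[cite: LawlerSchrammWernerEJP2002, §2 Lemma 2.2] -/
theorem contDiffAt_botExpect (hθ : θ ∈ Ioo 0 (2 * Real.pi)) : ContDiffAt ℝ 2 (botExpect κ ψ) θ := by
  obtain ⟨N, hN⟩ := eventually_mem_Ioo_level hθ
  have hθn := hN N le_rfl
  -- a short interval around `θ` inside the level-`N` interval
  set η := min (θ - 2 * level N) (2 * Real.pi - 2 * level N - θ) / 2 with hη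
  have hη0 : 0 < η := by
    have := lt_min (sub_pos.2 hθn.1) (by linarith [hθn.2] : 0 < 2 * Real.pi - 2 * level N - θ)
    rw [hη]; linarith
  have hθ₁ : 2 * level N ≤ θ - η := by
    have := min_le_left (θ - 2 * level N) (2 * Real.pi - 2 * level N - θ); rw [hη]; linarith
  have hθ₂ : θ + η ≤ 2 * Real.pi - 2 * level N := by
    have := min_le_right (θ - 2 * level N) (2 * Real.pi - 2 * level N - θ); rw [hη]; linarith
  have ha₁c : ContinuousOn (botExpect κ ψ') (Ioo 0 (2 * Real.pi)) := continuousOn_botExpect hκ hψ'c hψ'b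
  -- the explicit `C²` function
  set Φ : ℝ → ℝ := fun y ↦ harmSol κ (botExpect κ ψ') y +
    ((botExpect κ ψ (θ - η) - harmSol κ (botExpect κ ψ') (θ - η)) * (sleScale κ (θ + η) - sleScale κ y) +
      (botExpect κ ψ (θ + η) - harmSol κ (botExpect κ ψ') (θ + η)) * (sleScale κ y - sleScale κ (θ - η))) /
      (sleScale κ (θ + η) - sleScale κ (θ - η)) with hΦ
  have heq : botExpect κ ψ =ᶠ[𝓝 θ] Φ := by
    filter_upwards [Ioo_mem_nhds (show θ - η < θ by linarith) (show θ < θ + η by linarith)] with y hy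
    exact botExpect_eq_harmSol_add (n := N) hκ hψ hψ'c hψb hψ'b hθ₁ hθ₂ hy
  have hsC : ContDiffOn ℝ 2 (sleScale κ) (Ioo 0 (2 * Real.pi)) := contDiffOn_sleScale hκ
  have hΦc : ContDiffOn ℝ 2 Φ (Ioo 0 (2 * Real.pi)) := by
    refine (contDiffOn_harmSol ha₁c).add (ContDiffOn.div_const (ContDiffOn.add ?_ ?_) _)
    · exact contDiffOn_const.mul (contDiffOn_const.sub hsC)
    · exact contDiffOn_const.mul (hsC.sub contDiffOn_const)
  exact ((hΦc.contDiffAt (isOpen_Ioo.mem_nhds hθ)).congr_of_eventuallyEq heq)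

/-- **LSW's equation (2.4) in the space variable for `b_ψ`**:
`(κ/2) b_ψ'' + cot(θ/2) b_ψ' = -b_{ψ'}` on `(0, 2π)`, with the tree's `expGenerator κ 0`.
[cite: LawlerSchrammWernerEJP2002, §2 Lemma 2.2 (2.4)] -/
theorem expGenerator_botExpect_eq (hθ : θ ∈ Ioo 0 (2 * Real.pi)) :
    expGenerator κ 0 (botExpect κ ψ) θ = -botExpect κ ψ' θ := by
  obtain ⟨N, hN⟩ := eventually_mem_Ioo_level hθ
  have hθn := hN N le_rfl
  set η := min (θ - 2 * level N) (2 * Real.pi - 2 * level N - θ) / 2 with hη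
  have hη0 : 0 < η := by
    have := lt_min (sub_pos.2 hθn.1) (by linarith [hθn.2] : 0 < 2 * Real.pi - 2 * level N - θ)
    rw [hη]; linarith
  have hθ₁ : 2 * level N ≤ θ - η := by
    have := min_le_left (θ - 2 * level N) (2 * Real.pi - 2 * level N - θ); rw [hη]; linarith
  have hθ₂ : θ + η ≤ 2 * Real.pi - 2 * level N := by
    have := min_le_right (θ - 2 * level N) (2 * Real.pi - 2 * level N - θ); rw [hη]; linarith
  have ha₁c : ContinuousOn (botExpect κ ψ') (Ioo 0 (2 * Real.pi)) := continuousOn_botExpect hκ hψ'c hψ'b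
  set k₁ := botExpect κ ψ (θ - η) - harmSol κ (botExpect κ ψ') (θ - η) with hk₁
  set k₂ := botExpect κ ψ (θ + η) - harmSol κ (botExpect κ ψ') (θ + η) with hk₂
  set D := sleScale κ (θ + η) - sleScale κ (θ - η) with hD
  set Φ : ℝ → ℝ := fun y ↦ harmSol κ (botExpect κ ψ') y +
    (k₁ * (sleScale κ (θ + η) - sleScale κ y) + k₂ * (sleScale κ y - sleScale κ (θ - η))) / D with hΦ
  have heq : botExpect κ ψ =ᶠ[𝓝 θ] Φ := by
    filter_upwards [Ioo_mem_nhds (show θ - η < θ by linarith) (show θ < θ + η by linarith)] with y hy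
    exact botExpect_eq_harmSol_add (n := N) hκ hψ hψ'c hψb hψ'b hθ₁ hθ₂ hy
  rw [expGenerator_congr heq]
  -- `Φ = w + (c₀ + c₁ s)` with `Λ₀ w = -b_{ψ'}` and `Λ₀ (c₀ + c₁ s) = c₁ Λ₀ s = 0`
  set c₀ := (k₁ * sleScale κ (θ + η) - k₂ * sleScale κ (θ - η)) / D with hc₀
  set c₁ := (k₂ - k₁) / D with hc₁
  have hΦ' : Φ = fun y ↦ harmSol κ (botExpect κ ψ') y + (c₀ + c₁ * sleScale κ y) := by
    funext y; simp only [hΦ, hc₀, hc₁]; ring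
  rw [hΦ']
  have hw2 : ContDiffOn ℝ 2 (harmSol κ (botExpect κ ψ')) (Ioo 0 (2 * Real.pi)) := contDiffOn_harmSol ha₁c
  have hq2 : ContDiffOn ℝ 2 (fun y ↦ c₀ + c₁ * sleScale κ y) (Ioo 0 (2 * Real.pi)) :=
    contDiffOn_const.add (contDiffOn_const.mul (contDiffOn_sleScale hκ))
  rw [expGenerator_add_of_contDiffOn isOpen_Ioo hw2 hq2 hθ, expGenerator_harmSol hκ ha₁c hθ,
    expGenerator_const_add, expGenerator_const_mul, expGenerator_sleScale hκ hθ]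
  ring

end Regularity

end RadialLoewner

end Literature.Probability.RandomPlanarGeometry
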